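import Summits.QuantumFields.YangMills.Theorems.UnitScaleTiltProp7ComplementaryProjectorBlockDecayKnit
import HarnessLib

/-!
# Route `UnitScaleTilt`, crux K1 «MinimiserStabilityRegPr» (stmt-QuantumFields-19200), EX row `hGF[Lift]` ∕ `h349[Lift]` (curved member) — **LOD LINE BRICK (L5′-member), FILE B6
# (routeR-w2 g12 «bridge», w5 g13 01:07:02Z (K2b)): THE β-ROW IN MATRIX LETTERS — for the matrix `A = [P]_{b_F}` of print's complementary projector `P = 1 − R_{Q″}(U₀)` in px17's fine
# site⊗entry spike basis `b_F` and the block map `blk i = iterBlockOf (K − n) i.1`, the block bilinear bound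
# `‖Σ_{i∈X}Σ_{k∈Y} ū_i A_{ik} w_k‖ ≤ βb(X,Y)·√(Σ_{i∈X}|u_i|²)·√(Σ_{k∈Y}|w_k|²)`, `βb(X,Y) = (8C_P²C_T e^{3μ})²·C_N·cV′²·e^{−μ′·tdist(X,Y)}` — EXACTLY the binder `hA` of
# w5 g13's ✓p750965 ∕ ✓p754058 (`norm_imsError…_of_blockBound_perturbed`, `sum_normSq_comm_le_of_blockBound_perturbed`), from B4 ✓`norm_inner_sub_projR_blocks_le`.**

Cell `ym3-torus` (HUMAN RULING D-0037, YM ladder rung R3 — NOT d = 4, NOT infinite volume, NOT a mass gap, NOT Clay).  Width seat `ym-routeR-w2` gen 12 (D-0154 (3c); ★p1 g24 00:40:07Z CHAIR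
BOOK slot `hK₂`; ★★OWNER RULINGS №33∕№35).  THEOREMS ONLY (0 `def`, 0 `sorry`); px5 g11's member letters VERBATIM + `G hAG hGA`; `--supports stmt-QuantumFields-19200 --as helper`, count-neutral.
HONEST LABEL (№33 (6)): curved γ-row ∕ (3.49) supplier line (LOD localisation); a change of letters (operator pairing ↦ matrix entries in an orthonormal basis), no new analysis;
CONDITIONAL exactly as B4 (`hcoer`, window at `μ`, gap at `μ′`; the `RegPr` edition discharges `hcoer`∕`C_T`∕`C_G` as B5); nothing of (3.49), Thm 3.1∕3.3, `h349`, `hGF`, (L5″), (L6),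
EX ∕ 19200 is proved here; no summit statement is proved by this seat.

THE MATHEMATICS.  `A i k = ⟪b_F i, P(b_F k)⟫` (Mathlib `toMatrixOrthonormal_apply_apply`), so `Σ_{i∈X}Σ_{k∈Y} ū_i A_{ik} w_k = ⟪f_X, P g_Y⟫` with `f_X = Σ_{i∈X} u_i•b_F i`,
`g_Y = Σ_{k∈Y} w_k•b_F k` (§1).  `f_X = toL2S ũ` with `ũ = (toL2S)⁻¹ f_X` supported in `B(X)` because `(toL2S)⁻¹(b_F i) = δ_{i.1}⊗((√c₀)⁻¹E)` (§2), and `‖f_X‖² = Σ_{i∈X}|u_i|²`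
(orthonormality, px17 ✓`norm_sq_sum_smul_orthonormalBasis` on the zero-extended coefficients, §2).  B4 at `(z, z′, u, w) := (X, Y, ũ, w̃)` is the claim (§3).

WHAT IS PROVED (ns `Summit.QuantumFields.YangMills.Theorems.Prop7ComplementaryProjectorBlockDecay`, continued).
* §1 `blockForm_toMatrix_eq_inner` (the block bilinear form of `[P]_{b_F}` is the pairing `⟪f_X, P g_Y⟫`).
* §2 `toL2S_symm_spike_eq` · `toL2S_symm_blockSum_eq_zero_off_block` (`ũ ⊂ B(X)`) · `norm_blockSum_spike_eq` (`‖f_X‖ = √Σ_{i∈X}|u_i|²`).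
* §3 ★★★ `kernelMatrix_blockBound` (w5's `hA`, hypothesis form of B4) · ★★★ `kernelMatrix_blockBound_of_regPr` (`RegPr` edition of B5: `C_T = √s`, `C_G = C_P²`, px10's `m_B`).

References: T. Bałaban, CMP **99** (1985) 389–434 [Balaban1985BackgroundPropagators] ((3.11) p.392, (3.21)–(3.25) p.394, Thm 3.1 (3.46) p.398, (3.49) p.399); CMP **116** (1988) 1–22
[Balaban1988RG2Cluster] ((2.7) p.13).
-/

set_option autoImplicit false

noncomputable section

open scoped BigOperators Matrix.Norms.L2Operator InnerProductSpace ComplexConjugate Matrix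

namespace Summit.QuantumFields.YangMills.Theorems.Prop7ComplementaryProjectorBlockDecay

open Literature.MathematicalPhysics.QuantumFieldTheory.Balaban1983to89
open Finset
open T4Continuum BlockAveraging
open BlockAveraging (Idx)
open B7Prop1Explicit (U1 disp)
open B5Eq118OneStroke (iterBlockOf iterBlock mem_iterBlock card_iterBlock)
open B10Eq27TorusAxialLog (holT transl)
open B7TransferAnalyticMean (meanCLM)
open B9Eq311L2Pairing (WL2)
open B11Eq103H1Complex (SiteL2K BondL2K projR)
open Summit.QuantumFields.YangMills.Theorems.Prop8Chart (emlIterU)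
open Literature.MathematicalPhysics.QuantumFieldTheory.Balaban1983to89.T3ContinuumYM3Torus
open T3SectALandauChart (eta eta_pos bgUnits)
open T3PrintedRegularMinimiser (RegPr)
open T3PrintedRegularOrbits (sites_eq)
open T3LevelShift (siteShift)
open Summit.QuantumFields.YangMills.Theorems.Prop7SectET3Transport (periodsT3)
open Summit.QuantumFields.YangMills.Theorems.Prop7SectET3HilbertLetters (W₂ toL2 toL2S DL2 DstarL2 covLapSite adjoint_DL2 inner_toL2)
open Summit.QuantumFields.YangMills.Theorems.Prop7SectET3RealCoordSums (inner_toL2S)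
open Summit.QuantumFields.YangMills.Theorems.Prop7MassivePropagatorAgmonLetters (topMean_blockConst_smul inner_toL2S_smul_left norm_toL2S_smul_le normSq_lift_topMean_le)
open Summit.QuantumFields.YangMills.Theorems.Prop7MassivePropagatorCoercive (norm_le_of_massive_eq)
open Summit.QuantumFields.YangMills.Theorems.Prop7CoarseGramCoercivity (coarseGram_coercive)
open Summit.QuantumFields.YangMills.Theorems.Prop7MassiveConjugateResolvent (lift_topMean_weight_eq norm_weight_massive_inverse_sub_le)
open Summit.QuantumFields.YangMills.Theorems.Prop7ComplementaryProjectorColumns (norm_adjoint_le)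
open Summit.QuantumFields.YangMills.Theorems.Prop7GramConjAccretive (gram_inv_entry_decay)
open Summit.QuantumFields.YangMills.Theorems.Prop7SpanProjectorGramForm (gram_eq_conjTranspose_mul_coords triple_sum_exp_le)
open Summit.QuantumFields.YangMills.Theorems.Prop7SiteEntryCoordinates (orthonormal_spike top_le_span_spike inner_spike_toL2S norm_sq_sum_smul_orthonormalBasis
  toMatrixOrthonormal_apply_eq_inner)
open Summit.QuantumFields.YangMills.Theorems.Prop7BlockDistanceWeights (exists_blockDistanceWeight sum_exp_neg_mul_tdist_coarse_le tdist_coarse_comm tdist_coarse_triangle)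
open Summit.QuantumFields.YangMills.Theorems.Prop7ComplementaryProjectorColumns (isUnit_gram_massive_columns norm_inner_sub_projR_le norm_inner_massive_column_le)
open Summit.QuantumFields.YangMills.Theorems.Prop7CoarseGramInverseDecay (spike_eq_lift norm_gram_inv_spike_le_exp_neg_tdist)
open Summit.QuantumFields.YangMills.Theorems.Prop7TopMeanAdjointBlockLocal (inner_blockLift_eq_zero_of_disjoint adjoint_apply_eq_zero_off_block)
open Literature.MathematicalPhysics.QuantumFieldTheory.Balaban1983to89.Beta.CombesThomasForm (abs_exp_sub_one_le)

variable (F : T3Family) {n K : ℕ} (h : n ≤ K) {c₀ c₁ : ℝ} [Fact (0 < c₀)] [Fact (0 < c₁)]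
  {ε₀ : ℝ} (hε₀ : 0 < ε₀) (hε7 : 10 ^ 7 * (F.L : ℝ) ^ 3 * ε₀ ≤ 1)
  (U₀ : GaugeField (F.P K) 0 (Matrix.specialUnitaryGroup (Fin 2) ℂ)) (hreg : RegPr F n K ε₀ U₀)
  (Q'' : SiteL2K ℂ 3 (periodsT3 F K) c₀ W₂ →ₗ[ℂ] (Site (F.P K) (K - n) → Matrix (Fin 2) (Fin 2) ℂ))
  (hseq : ∀ lam : Site (F.P K) 0 → Matrix (Fin 2) (Fin 2) ℂ, ∃ ns : (j : ℕ) → Site (F.P K) j → Matrix (Fin 2) (Fin 2) ℂ, ns 0 = lam ∧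
      (∀ (j : ℕ) (y : Site (F.P K) (j + 1)), ns (j + 1) y = ns j (emb y) - meanCLM (Idx (F.P K)) (Matrix (Fin 2) (Fin 2) ℂ) fun i : Idx (F.P K) =>
        ns j (emb y) - ((holT (emlIterU j (bgUnits F K U₀)) (emb y) (stairWord i.2.1 (off i.1)) : (Matrix (Fin 2) (Fin 2) ℂ)ˣ) : Matrix (Fin 2) (Fin 2) ℂ) *
          ns j (transl (emb y) (disp (stairWord i.2.1 (off i.1)))) * (((holT (emlIterU j (bgUnits F K U₀)) (emb y) (stairWord i.2.1 (off i.1)))⁻¹ : (Matrix (Fin 2) (Fin 2) ℂ)ˣ) : Matrix (Fin 2) (Fin 2) ℂ)) ∧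
      ns (K - n) = Q'' (toL2S F K c₀ lam))
  (ι : (Site (F.P K) (K - n) → Matrix (Fin 2) (Fin 2) ℂ) →ₗ[ℂ] SiteL2K ℂ 3 (periodsT3 F n) c₁ W₂)
  (hι : ∀ c, ι c = toL2S F n c₁ (fun z => c (siteShift (sites_eq F n K h) z)))
  (T : SiteL2K ℂ 3 (periodsT3 F n) c₁ W₂ →ₗ[ℂ] SiteL2K ℂ 3 (periodsT3 F K) c₀ W₂)
  (hT : ∀ (l : SiteL2K ℂ 3 (periodsT3 F K) c₀ W₂) (f : SiteL2K ℂ 3 (periodsT3 F n) c₁ W₂), ⟪ι (Q'' l), f⟫_ℂ = ⟪l, T f⟫_ℂ)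
  {a : ℝ} (ha : 0 < a)
  (G : SiteL2K ℂ 3 (periodsT3 F K) c₀ W₂ →ₗ[ℂ] SiteL2K ℂ 3 (periodsT3 F K) c₀ W₂)
  (hAG : ∀ f, covLapSite F n K c₀ U₀ (G f) + (a : ℂ) • T (ι (Q'' (G f))) = f)
  (hGA : ∀ u, G (covLapSite F n K c₀ U₀ u + (a : ℂ) • T (ι (Q'' u))) = u)

/-! ## §1 The block bilinear form of `[P]_{b_F}` is a pairing -/

omit [Fact (0 < c₁)] in
/-- **BLOCK BILINEAR FORM = PAIRING**: for any linear `P` on the fine space, any finite index sets `s`, `t` and coefficient vectors `u`, `w`,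
`Σ_{i∈s}Σ_{k∈t} star(u i)·[P]_{b_F} i k·w k = ⟪Σ_{i∈s} u_i•b_F i, P(Σ_{k∈t} w_k•b_F k)⟫` (`[P] i k = ⟪b_F i, P(b_F k)⟫`). [folklore] -/
theorem blockForm_toMatrix_eq_inner (P : SiteL2K ℂ 3 (periodsT3 F K) c₀ W₂ →ₗ[ℂ] SiteL2K ℂ 3 (periodsT3 F K) c₀ W₂) (s t : Finset (Site (F.P K) 0 × (Fin 2 × Fin 2)))
    (u w : Site (F.P K) 0 × (Fin 2 × Fin 2) → ℂ) :
    ∑ i ∈ s, ∑ k ∈ t, star (u i) * LinearMap.toMatrixOrthonormal (OrthonormalBasis.mk (orthonormal_spike F) (top_le_span_spike F) : OrthonormalBasis (Site (F.P K) 0 × (Fin 2 × Fin 2)) ℂ (SiteL2K ℂ 3 (periodsT3 F K) c₀ W₂)) P i k * w k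
      = ⟪∑ i ∈ s, u i • (OrthonormalBasis.mk (orthonormal_spike F) (top_le_span_spike F) : OrthonormalBasis (Site (F.P K) 0 × (Fin 2 × Fin 2)) ℂ (SiteL2K ℂ 3 (periodsT3 F K) c₀ W₂)) i, P (∑ k ∈ t, w k • (OrthonormalBasis.mk (orthonormal_spike F) (top_le_span_spike F) : OrthonormalBasis (Site (F.P K) 0 × (Fin 2 × Fin 2)) ℂ (SiteL2K ℂ 3 (periodsT3 F K) c₀ W₂)) k)⟫_ℂ := by
  rw [map_sum, sum_inner]
  refine Finset.sum_congr rfl fun i _ => ?_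
  rw [inner_smul_left, inner_sum, Finset.mul_sum]
  refine Finset.sum_congr rfl fun k _ => ?_
  rw [map_smul, inner_smul_right, toMatrixOrthonormal_apply_eq_inner, Complex.star_def]
  ring

/-! ## §2 Coefficient vectors supported in a block are block-supported site functions of the right norm -/

omit [Fact (0 < c₁)] in
/-- `(toL2S)⁻¹(b_F i) = δ_{i.1} ⊗ ((√c₀)⁻¹·E_{i.2})`. [cite: Balaban1985BackgroundPropagators, (3.11) p.392] -/
theorem toL2S_symm_spike_eq (i : Site (F.P K) 0 × (Fin 2 × Fin 2)) :
    (toL2S F K c₀).symm ((OrthonormalBasis.mk (orthonormal_spike F) (top_le_span_spike F) : OrthonormalBasis (Site (F.P K) 0 × (Fin 2 × Fin 2)) ℂ (SiteL2K ℂ 3 (periodsT3 F K) c₀ W₂)) i) = Pi.single i.1 ((((Real.sqrt c₀ : ℝ) : ℂ))⁻¹ • Matrix.single i.2.1 i.2.2 (1 : ℂ)) := by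
  simp only [OrthonormalBasis.coe_mk]
  rw [Pi.single_smul', ← LinearEquiv.map_smul, LinearEquiv.symm_apply_apply]

omit [Fact (0 < c₁)] in
/-- **COEFFICIENTS IN THE BLOCK `X` GIVE A SITE FUNCTION SUPPORTED IN `B(X)`**: `(toL2S)⁻¹(Σ_{i : blk i = X} u_i•b_F i) x = 0` whenever `iterBlockOf (K − n) x ≠ X`.
[cite: Balaban1985BackgroundPropagators, (3.21)-(3.25) p.394] -/
theorem toL2S_symm_blockSum_eq_zero_off_block (X : Site (F.P K) (K - n)) (u : Site (F.P K) 0 × (Fin 2 × Fin 2) → ℂ) (x : Site (F.P K) 0)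
    (hx : iterBlockOf (K - n) x ≠ X) :
    (toL2S F K c₀).symm (∑ i ∈ Finset.univ.filter (fun i : Site (F.P K) 0 × (Fin 2 × Fin 2) => iterBlockOf (K - n) i.1 = X), u i • (OrthonormalBasis.mk (orthonormal_spike F) (top_le_span_spike F) : OrthonormalBasis (Site (F.P K) 0 × (Fin 2 × Fin 2)) ℂ (SiteL2K ℂ 3 (periodsT3 F K) c₀ W₂)) i) x = 0 := by
  simp only [map_sum, map_smul, Finset.sum_apply, Pi.smul_apply, toL2S_symm_spike_eq]
  refine Finset.sum_eq_zero fun i hi => ?_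
  rw [Finset.mem_filter] at hi
  have hne : x ≠ i.1 := fun hxi => hx (by rw [hxi]; exact hi.2)
  rw [Pi.single_eq_of_ne hne, smul_zero]

omit [Fact (0 < c₁)] in
/-- **THE NORM OF A BLOCK SUM**: `‖Σ_{i : blk i = X} u_i•b_F i‖ = √(Σ_{i : blk i = X} ‖u_i‖²)` (orthonormality of `b_F`, zero-extended coefficients). [folklore] -/
theorem norm_blockSum_spike_eq (X : Site (F.P K) (K - n)) (u : Site (F.P K) 0 × (Fin 2 × Fin 2) → ℂ) :
    ‖∑ i ∈ Finset.univ.filter (fun i : Site (F.P K) 0 × (Fin 2 × Fin 2) => iterBlockOf (K - n) i.1 = X), u i • (OrthonormalBasis.mk (orthonormal_spike F) (top_le_span_spike F) : OrthonormalBasis (Site (F.P K) 0 × (Fin 2 × Fin 2)) ℂ (SiteL2K ℂ 3 (periodsT3 F K) c₀ W₂)) i‖ = Real.sqrt (∑ i ∈ Finset.univ.filter (fun i : Site (F.P K) 0 × (Fin 2 × Fin 2) => iterBlockOf (K - n) i.1 = X), ‖u i‖ ^ 2) := by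
  have hsum : ∑ i ∈ Finset.univ.filter (fun i : Site (F.P K) 0 × (Fin 2 × Fin 2) => iterBlockOf (K - n) i.1 = X), u i • (OrthonormalBasis.mk (orthonormal_spike F) (top_le_span_spike F) : OrthonormalBasis (Site (F.P K) 0 × (Fin 2 × Fin 2)) ℂ (SiteL2K ℂ 3 (periodsT3 F K) c₀ W₂)) i
      = ∑ i, (if iterBlockOf (K - n) i.1 = X then u i else 0) • (OrthonormalBasis.mk (orthonormal_spike F) (top_le_span_spike F) : OrthonormalBasis (Site (F.P K) 0 × (Fin 2 × Fin 2)) ℂ (SiteL2K ℂ 3 (periodsT3 F K) c₀ W₂)) i := by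
    rw [Finset.sum_filter]
    exact Finset.sum_congr rfl fun i _ => by split_ifs <;> simp
  have hsq : ∑ i ∈ Finset.univ.filter (fun i : Site (F.P K) 0 × (Fin 2 × Fin 2) => iterBlockOf (K - n) i.1 = X), ‖u i‖ ^ 2 = ∑ i : Site (F.P K) 0 × (Fin 2 × Fin 2), ‖(if iterBlockOf (K - n) i.1 = X then u i else 0)‖ ^ 2 := by
    rw [Finset.sum_filter]
    exact Finset.sum_congr rfl fun i _ => by split_ifs <;> simp
  rw [hsum, hsq, ← norm_sq_sum_smul_orthonormalBasis (OrthonormalBasis.mk (orthonormal_spike F) (top_le_span_spike F) : OrthonormalBasis (Site (F.P K) 0 × (Fin 2 × Fin 2)) ℂ (SiteL2K ℂ 3 (periodsT3 F K) c₀ W₂))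
    (fun i => if iterBlockOf (K - n) i.1 = X then u i else 0), Real.sqrt_sq (norm_nonneg _)]

/-! ## §3 ★★★ The β-row in matrix letters (w5 g13's `hA`) -/

include hε₀ hε7 hreg hseq hι hT ha hAG hGA in
set_option maxHeartbeats 400000 in
/-- ★★★ **THE β-ROW IN MATRIX LETTERS (hypothesis form)**: with `A := LinearMap.toMatrixOrthonormal b_F (LinearMap.id − projR (covLapSite F n K c₀ U₀) Q'')` (`b_F` px17's fine spikes), slopes
`0 ≤ μ′ < μ`, the window at `μ`, `‖ι(Q″λ)‖ ≤ C_T‖λ‖`, `‖G‖ ≤ C_G`, coarse coercivity `m_B` ((L4′)) and the gap at `μ′`: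
`‖Σ_{i : blk i = X} Σ_{k : blk k = Y} star(u i)·A i k·w k‖ ≤ βb X Y · √(Σ_{i : blk i = X}‖u i‖²) · √(Σ_{k : blk k = Y}‖w k‖²)`,
`βb X Y = (8C_P²C_T e^{3μ})²·((m_B²∕2 − 3ε(μ′)²)⁻¹e^{9μ′})·(4(2(1 + 1∕(μ−μ′)))³)²·e^{−μ′·tdist(X,Y)}` — the `hA` of ✓`sum_normSq_comm_le_of_blockBound_perturbed` ∕ ✓`norm_imsError_le_of_blockBound_perturbed`
(`blk i := iterBlockOf (K − n) i.1`, `βb` symmetric by ✓`tdist_coarse_comm`, `≥ 0`). [cite: Balaban1985BackgroundPropagators, Thm 3.1 (3.46) p.398, (3.49) p.399; Balaban1988RG2Cluster, (2.7) p.13] -/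
theorem kernelMatrix_blockBound {μ μ' : ℝ} (hμ' : 0 ≤ μ') (hμμ' : μ' < μ)
    {δ₁ : ℝ} (hδ₁ : 0 ≤ δ₁)
    (hδ : 3 * ((eta F n K)⁻¹) ^ 2 * (Real.exp (μ * eta F n K) - 1) ^ 2 + a * ((25 / 8) * (c₁ * ((((F.P K).L : ℝ) ^ (F.P K).d) ^ (K - n))⁻¹ / c₀)) * (Real.exp (3 * μ) - 1) ^ 2 ≤ δ₁ ^ 2)
    (hwin : Real.sqrt (max 2 (16 * c₀ * ((F.L : ℝ) ^ (K - n)) ^ 3 / (a * c₁))) * δ₁ ≤ 1 / 10)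
    {CT : ℝ} (hCT : 0 ≤ CT) (hCTb : ∀ l : SiteL2K ℂ 3 (periodsT3 F K) c₀ W₂, ‖ι (Q'' l)‖ ≤ CT * ‖l‖)
    {CG : ℝ} (hCG : 0 ≤ CG) (hGn : ∀ f, ‖G f‖ ≤ CG * ‖f‖)
    {mB : ℝ} (hmB : 0 < mB) (hcoer : ∀ f : SiteL2K ℂ 3 (periodsT3 F n) c₁ W₂, mB * ‖f‖ ≤ ‖G (T f)‖)
    (hgap : 3 * ((Real.sqrt (max 2 (16 * c₀ * ((F.L : ℝ) ^ (K - n)) ^ 3 / (a * c₁))) * (2 + Real.sqrt (max 2 (16 * c₀ * ((F.L : ℝ) ^ (K - n)) ^ 3 / (a * c₁))))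
          * (Real.sqrt 3 * (eta F n K)⁻¹ * (Real.exp (μ' * eta F n K) - 1) + (Real.sqrt 3 * (eta F n K)⁻¹ * (Real.exp (μ' * eta F n K) - 1)) ^ 2 + Real.sqrt a * CT * (Real.exp (3 * μ') - 1) + a * CT ^ 2 * (Real.exp (3 * μ') - 1) ^ 2)
          * (8 * Real.sqrt (max 2 (16 * c₀ * ((F.L : ℝ) ^ (K - n)) ^ 3 / (a * c₁))) + 8 * Real.sqrt (max 2 (16 * c₀ * ((F.L : ℝ) ^ (K - n)) ^ 3 / (a * c₁))) ^ 2)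
          * (CT * (1 + (Real.exp (3 * μ') - 1))) + CG * (CT * (Real.exp (3 * μ') - 1)))) ^ 2 < mB ^ 2 / 2)
    (X Y : Site (F.P K) (K - n)) (u w : Site (F.P K) 0 × (Fin 2 × Fin 2) → ℂ) :
    ‖∑ i ∈ Finset.univ.filter (fun i : Site (F.P K) 0 × (Fin 2 × Fin 2) => iterBlockOf (K - n) i.1 = X), ∑ k ∈ Finset.univ.filter (fun k : Site (F.P K) 0 × (Fin 2 × Fin 2) => iterBlockOf (K - n) k.1 = Y),
        star (u i) * LinearMap.toMatrixOrthonormal (OrthonormalBasis.mk (orthonormal_spike F) (top_le_span_spike F) : OrthonormalBasis (Site (F.P K) 0 × (Fin 2 × Fin 2)) ℂ (SiteL2K ℂ 3 (periodsT3 F K) c₀ W₂)) (LinearMap.id - projR (covLapSite F n K c₀ U₀) Q'') i k * w k‖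
      ≤ ((8 * (max 2 (16 * c₀ * ((F.L : ℝ) ^ (K - n)) ^ 3 / (a * c₁))) * CT * Real.exp (3 * μ)) ^ 2
          * ((mB ^ 2 / 2 - 3 * ((Real.sqrt (max 2 (16 * c₀ * ((F.L : ℝ) ^ (K - n)) ^ 3 / (a * c₁))) * (2 + Real.sqrt (max 2 (16 * c₀ * ((F.L : ℝ) ^ (K - n)) ^ 3 / (a * c₁))))
          * (Real.sqrt 3 * (eta F n K)⁻¹ * (Real.exp (μ' * eta F n K) - 1) + (Real.sqrt 3 * (eta F n K)⁻¹ * (Real.exp (μ' * eta F n K) - 1)) ^ 2 + Real.sqrt a * CT * (Real.exp (3 * μ') - 1) + a * CT ^ 2 * (Real.exp (3 * μ') - 1) ^ 2)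
          * (8 * Real.sqrt (max 2 (16 * c₀ * ((F.L : ℝ) ^ (K - n)) ^ 3 / (a * c₁))) + 8 * Real.sqrt (max 2 (16 * c₀ * ((F.L : ℝ) ^ (K - n)) ^ 3 / (a * c₁))) ^ 2)
          * (CT * (1 + (Real.exp (3 * μ') - 1))) + CG * (CT * (Real.exp (3 * μ') - 1)))) ^ 2)⁻¹ * Real.exp (9 * μ'))
          * (4 * (2 * (1 + 1 / (μ - μ'))) ^ 3) ^ 2
          * Real.exp (-(μ' * (Site.tdist X Y : ℝ))))
        * Real.sqrt (∑ i ∈ Finset.univ.filter (fun i : Site (F.P K) 0 × (Fin 2 × Fin 2) => iterBlockOf (K - n) i.1 = X), ‖u i‖ ^ 2)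
        * Real.sqrt (∑ k ∈ Finset.univ.filter (fun k : Site (F.P K) 0 × (Fin 2 × Fin 2) => iterBlockOf (K - n) k.1 = Y), ‖w k‖ ^ 2) := by
  classical
  rw [blockForm_toMatrix_eq_inner, ← norm_blockSum_spike_eq F (c₀ := c₀) X u, ← norm_blockSum_spike_eq F (c₀ := c₀) Y w]
  have hfX := ((toL2S F K c₀).apply_symm_apply (∑ i ∈ Finset.univ.filter (fun i : Site (F.P K) 0 × (Fin 2 × Fin 2) => iterBlockOf (K - n) i.1 = X), u i • (OrthonormalBasis.mk (orthonormal_spike F) (top_le_span_spike F) : OrthonormalBasis (Site (F.P K) 0 × (Fin 2 × Fin 2)) ℂ (SiteL2K ℂ 3 (periodsT3 F K) c₀ W₂)) i)).symm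
  have hgY := ((toL2S F K c₀).apply_symm_apply (∑ k ∈ Finset.univ.filter (fun k : Site (F.P K) 0 × (Fin 2 × Fin 2) => iterBlockOf (K - n) k.1 = Y), w k • (OrthonormalBasis.mk (orthonormal_spike F) (top_le_span_spike F) : OrthonormalBasis (Site (F.P K) 0 × (Fin 2 × Fin 2)) ℂ (SiteL2K ℂ 3 (periodsT3 F K) c₀ W₂)) k)).symm
  rw [hfX, hgY, LinearMap.sub_apply, LinearMap.id_apply]
  have hmain := norm_inner_sub_projR_blocks_le F h hε₀ hε7 U₀ hreg Q'' hseq ι hι T hT ha G hAG hGA hμ' hμμ' hδ₁ hδ hwin hCT hCTb hCG hGn hmB hcoer hgap X Y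
    _ _ (toL2S_symm_blockSum_eq_zero_off_block F (c₀ := c₀) X u) (toL2S_symm_blockSum_eq_zero_off_block F (c₀ := c₀) Y w)
  refine hmain.trans (le_of_eq ?_)
  ring

include hε₀ hε7 hreg hseq hι hT ha hAG hGA in
set_option maxHeartbeats 400000 in
/-- ★★★ **THE β-ROW IN MATRIX LETTERS AT `RegPr`** (`n < K`): §3 with `C_T := √s`, `C_G := C_P²`, `m_B :=` px10's ✓`coarseGram_coercive` constant discharged (B5 `norm_lift_topMean_le`,
`norm_massive_inverse_le`, `coarseCoercivity_pos`); only the window at `μ` and the gap at `μ′` remain. [cite: Balaban1985BackgroundPropagators, Thm 3.1 (3.46) p.398, (3.49) p.399] -/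
theorem kernelMatrix_blockBound_of_regPr (hnK : n < K) {μ μ' : ℝ} (hμ' : 0 ≤ μ') (hμμ' : μ' < μ)
    {δ₁ : ℝ} (hδ₁ : 0 ≤ δ₁)
    (hδ : 3 * ((eta F n K)⁻¹) ^ 2 * (Real.exp (μ * eta F n K) - 1) ^ 2 + a * ((25 / 8) * (c₁ * ((((F.P K).L : ℝ) ^ (F.P K).d) ^ (K - n))⁻¹ / c₀)) * (Real.exp (3 * μ) - 1) ^ 2 ≤ δ₁ ^ 2)
    (hwin : Real.sqrt (max 2 (16 * c₀ * ((F.L : ℝ) ^ (K - n)) ^ 3 / (a * c₁))) * δ₁ ≤ 1 / 10)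
    (hgap : 3 * ((Real.sqrt (max 2 (16 * c₀ * ((F.L : ℝ) ^ (K - n)) ^ 3 / (a * c₁))) * (2 + Real.sqrt (max 2 (16 * c₀ * ((F.L : ℝ) ^ (K - n)) ^ 3 / (a * c₁))))
          * (Real.sqrt 3 * (eta F n K)⁻¹ * (Real.exp (μ' * eta F n K) - 1) + (Real.sqrt 3 * (eta F n K)⁻¹ * (Real.exp (μ' * eta F n K) - 1)) ^ 2 + Real.sqrt a * (Real.sqrt ((25 / 8) * (c₁ * ((((F.P K).L : ℝ) ^ (F.P K).d) ^ (K - n))⁻¹ / c₀))) * (Real.exp (3 * μ') - 1) + a * (Real.sqrt ((25 / 8) * (c₁ * ((((F.P K).L : ℝ) ^ (F.P K).d) ^ (K - n))⁻¹ / c₀))) ^ 2 * (Real.exp (3 * μ') - 1) ^ 2)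
          * (8 * Real.sqrt (max 2 (16 * c₀ * ((F.L : ℝ) ^ (K - n)) ^ 3 / (a * c₁))) + 8 * Real.sqrt (max 2 (16 * c₀ * ((F.L : ℝ) ^ (K - n)) ^ 3 / (a * c₁))) ^ 2)
          * ((Real.sqrt ((25 / 8) * (c₁ * ((((F.P K).L : ℝ) ^ (F.P K).d) ^ (K - n))⁻¹ / c₀))) * (1 + (Real.exp (3 * μ') - 1))) + (max 2 (16 * c₀ * ((F.L : ℝ) ^ (K - n)) ^ 3 / (a * c₁))) * ((Real.sqrt ((25 / 8) * (c₁ * ((((F.P K).L : ℝ) ^ (F.P K).d) ^ (K - n))⁻¹ / c₀))) * (Real.exp (3 * μ') - 1)))) ^ 2 < (2 / ((1 + (25 / 8) * (c₁ * ((((F.P K).L : ℝ) ^ (F.P K).d) ^ (K - n))⁻¹ / c₀)) * (600 * (27 / 4 : ℝ) ^ 6 * (c₀ * ((F.L : ℝ) ^ 3) ^ (K - n) / c₁) + a))) ^ 2 / 2)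
    (X Y : Site (F.P K) (K - n)) (u w : Site (F.P K) 0 × (Fin 2 × Fin 2) → ℂ) :
    ‖∑ i ∈ Finset.univ.filter (fun i : Site (F.P K) 0 × (Fin 2 × Fin 2) => iterBlockOf (K - n) i.1 = X), ∑ k ∈ Finset.univ.filter (fun k : Site (F.P K) 0 × (Fin 2 × Fin 2) => iterBlockOf (K - n) k.1 = Y),
        star (u i) * LinearMap.toMatrixOrthonormal (OrthonormalBasis.mk (orthonormal_spike F) (top_le_span_spike F) : OrthonormalBasis (Site (F.P K) 0 × (Fin 2 × Fin 2)) ℂ (SiteL2K ℂ 3 (periodsT3 F K) c₀ W₂)) (LinearMap.id - projR (covLapSite F n K c₀ U₀) Q'') i k * w k‖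
      ≤ ((8 * (max 2 (16 * c₀ * ((F.L : ℝ) ^ (K - n)) ^ 3 / (a * c₁))) * Real.sqrt ((25 / 8) * (c₁ * ((((F.P K).L : ℝ) ^ (F.P K).d) ^ (K - n))⁻¹ / c₀)) * Real.exp (3 * μ)) ^ 2
          * (((2 / ((1 + (25 / 8) * (c₁ * ((((F.P K).L : ℝ) ^ (F.P K).d) ^ (K - n))⁻¹ / c₀)) * (600 * (27 / 4 : ℝ) ^ 6 * (c₀ * ((F.L : ℝ) ^ 3) ^ (K - n) / c₁) + a))) ^ 2 / 2 - 3 * ((Real.sqrt (max 2 (16 * c₀ * ((F.L : ℝ) ^ (K - n)) ^ 3 / (a * c₁))) * (2 + Real.sqrt (max 2 (16 * c₀ * ((F.L : ℝ) ^ (K - n)) ^ 3 / (a * c₁))))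
          * (Real.sqrt 3 * (eta F n K)⁻¹ * (Real.exp (μ' * eta F n K) - 1) + (Real.sqrt 3 * (eta F n K)⁻¹ * (Real.exp (μ' * eta F n K) - 1)) ^ 2 + Real.sqrt a * (Real.sqrt ((25 / 8) * (c₁ * ((((F.P K).L : ℝ) ^ (F.P K).d) ^ (K - n))⁻¹ / c₀))) * (Real.exp (3 * μ') - 1) + a * (Real.sqrt ((25 / 8) * (c₁ * ((((F.P K).L : ℝ) ^ (F.P K).d) ^ (K - n))⁻¹ / c₀))) ^ 2 * (Real.exp (3 * μ') - 1) ^ 2)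
          * (8 * Real.sqrt (max 2 (16 * c₀ * ((F.L : ℝ) ^ (K - n)) ^ 3 / (a * c₁))) + 8 * Real.sqrt (max 2 (16 * c₀ * ((F.L : ℝ) ^ (K - n)) ^ 3 / (a * c₁))) ^ 2)
          * ((Real.sqrt ((25 / 8) * (c₁ * ((((F.P K).L : ℝ) ^ (F.P K).d) ^ (K - n))⁻¹ / c₀))) * (1 + (Real.exp (3 * μ') - 1))) + (max 2 (16 * c₀ * ((F.L : ℝ) ^ (K - n)) ^ 3 / (a * c₁))) * ((Real.sqrt ((25 / 8) * (c₁ * ((((F.P K).L : ℝ) ^ (F.P K).d) ^ (K - n))⁻¹ / c₀))) * (Real.exp (3 * μ') - 1)))) ^ 2)⁻¹ * Real.exp (9 * μ'))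
          * (4 * (2 * (1 + 1 / (μ - μ'))) ^ 3) ^ 2
          * Real.exp (-(μ' * (Site.tdist X Y : ℝ))))
        * Real.sqrt (∑ i ∈ Finset.univ.filter (fun i : Site (F.P K) 0 × (Fin 2 × Fin 2) => iterBlockOf (K - n) i.1 = X), ‖u i‖ ^ 2)
        * Real.sqrt (∑ k ∈ Finset.univ.filter (fun k : Site (F.P K) 0 × (Fin 2 × Fin 2) => iterBlockOf (K - n) k.1 = Y), ‖w k‖ ^ 2) :=
  kernelMatrix_blockBound F h hε₀ hε7 U₀ hreg Q'' hseq ι hι T hT ha G hAG hGA hμ' hμμ' hδ₁ hδ hwin (Real.sqrt_nonneg _)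
    (norm_lift_topMean_le F h hε₀ hε7 U₀ hreg Q'' hseq ι hι) (by positivity) (norm_massive_inverse_le F h hε₀ hε7 U₀ hreg Q'' hseq ι hι T hT ha G hAG)
    (coarseCoercivity_pos F ha) (coarseGram_coercive F hnK h hε₀ hε7 U₀ hreg Q'' hseq ι hι T hT ha G hAG) hgap X Y u w

end Summit.QuantumFields.YangMills.Theorems.Prop7ComplementaryProjectorBlockDecay

end
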